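import Literature.Topology.FourManifolds.ProjectiveLineRotationField
import Literature.Topology.FourManifolds.MapsToSphereNullhomotopic
import Mathlib.Geometry.Manifold.WhitneyEmbedding
import Mathlib.Topology.Homotopy.Equiv
import HarnessLib

/-!
# An embedded `2`-sphere in a homotopy `4`-sphere has a trivial normal bundle (framed tube)

Topic `Literature/Topology/FourManifolds`. We **prove** Kirby's Theorem VIII.2 (R. C. Kirby,
*The Topology of 4-Manifolds* (1989), Ch. VIII, Thm. 2, p. 44: an oriented `Mᵐ ⊂ Q^{m+2}`
with `[M] = 0 ∈ H_m(Q; ℤ)` has a trivial normal bundle) in the case the tree needs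
(`Literature.Geometry.Symplectic.jPlanePencil_localFamily_homotopySphere`: capped pencil members in
a homotopy `4`-sphere): **a smooth injective immersion `c : ℂℙ¹ → M` of the Riemann sphere into a
compact `4`-manifold homotopy equivalent to `S⁴` has a framed tubular neighbourhood**
`ν : ℂℙ¹ × ℝ² ↪ M`, `ν (y, 0) = c y` (`exists_framedTube_of_homotopyEquiv_sphere_four`).

The proof assembles the tree's bricks: a Whitney embedding `e : M → ℝⁿ` (Mathlib's
`exists_embedding_euclidean_of_compact`) gives the data `CodimTwoData 2 M ℂℙ¹ ℝⁿ`
(`EmbeddedSurfaceNormalPlane.lean`); the normal planes of the sphere carry a rotation field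
(`ProjectiveLineRotationField.lean` — the normal bundle of a `2`-sphere is orientable); `c` is
null-homotopic through a homotopy from a point off `c(ℂℙ¹)` (this file: every map `ℂℙ¹ → S⁴` is
null-homotopic — smooth approximation, the cone over a `C¹` image of a `2`-manifold in `ℝ⁵` has
Hausdorff dimension `≤ 3` (`dimH_cone_range_le_of_contMDiff`), so the normalised approximation
misses a point and contracts (`homotopic_const_of_forall_ne`) — transported through `M ≃ₕ S⁴`;
a point of `M` off the `C¹` image `c(ℂℙ¹)`, joined to it by an arc, exists in any chart by the
density of the complement of `C¹` images of `2`-manifolds in `ℝ⁴`, `dense_compl_image_of_contMDiffOn`);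
and the transport argument of `NullhomotopicNormalFraming.lean`
(`CodimTwoData.exists_framedTube_of_nullhomotopic`) gives the framed tube.

Everything here is proved; no named facts are introduced (D-0026).

## References

* R. C. Kirby, *The Topology of 4-Manifolds*, LNM 1374, Springer (1989), Ch. VIII, Thm. 2 and its
  proof, pp. 44–45. [Kirby1989]
* M. W. Hirsch, *Differential Topology* (1976), Ch. 3 §1 Prop. 1.2 (nowhere density of `C¹`
  images of lower-dimensional manifolds), Ch. 4 §5 (tubular neighbourhoods). [HirschDT1976]
-/

open scoped Manifold ContDiff Topology
open Set Function Metric Module Filter ContinuousMap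

noncomputable section

namespace Literature.Topology.FourManifolds

/-! ### A point off the image of the sphere, joined to it by an arc -/

section OffRange

variable {M : Type*} [TopologicalSpace M] [ChartedSpace (EuclideanSpace ℝ (Fin 4)) M]
  [IsManifold (𝓡 4) ∞ M]

/-- **A `C¹` map from the Riemann sphere into a `4`-manifold misses a point joined to its image
by an arc**: read in the chart at `c y₀`, the complement of the image is dense (Hirsch Ch. 3 §1
Prop. 1.2, the tree's `dense_compl_image_of_contMDiffOn`), so a small chart ball around `c y₀`
contains a point `a` off the image, and the chart segment joins `c y₀` to `a`.
[cite: HirschDT1976, Ch. 3 §1, Prop. 1.2] -/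
theorem exists_notMem_range_joined (c : ComplexProjectiveSpace 1 → M)
    (hc : ContMDiff (𝓡 2) (𝓡 4) 1 c) (y₀ : ComplexProjectiveSpace 1) :
    ∃ a : M, a ∉ range c ∧ Joined (c y₀) a := by
  set x₀ := c y₀ with hx₀
  set φ := extChartAt (𝓡 4) x₀ with hφ
  -- a chart ball around `φ x₀`
  obtain ⟨r, hr, hball⟩ := Metric.isOpen_iff.1 (isOpen_extChartAt_target (I := 𝓡 4) x₀) (φ x₀)
    (mem_extChartAt_target x₀)
  -- the image of the sphere in the chart has dense complement
  set s : Set (ComplexProjectiveSpace 1) := c ⁻¹' φ.source with hs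
  have hso : IsOpen s := (isOpen_extChartAt_source (I := 𝓡 4) x₀).preimage hc.continuous
  have hf : ContMDiffOn (𝓡 2) 𝓘(ℝ, EuclideanSpace ℝ (Fin 4)) 1 (φ ∘ c) s := by
    refine (contMDiffOn_extChartAt (n := 1) (x := x₀)).comp hc.contMDiffOn fun y hy => ?_
    rw [← extChartAt_source (𝓡 4)]
    exact hy
  have hdense : Dense ((φ ∘ c) '' s)ᶜ :=
    dense_compl_image_of_contMDiffOn (I := 𝓡 2) hso hf (by simp)
  obtain ⟨w, hwball, hwT⟩ := hdense.inter_open_nonempty (ball (φ x₀) r) isOpen_ball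
    ⟨φ x₀, mem_ball_self hr⟩
  have hwt : w ∈ φ.target := hball hwball
  refine ⟨φ.symm w, ?_, ?_⟩
  · -- off the image
    rintro ⟨y, hy⟩
    apply hwT
    have hys : y ∈ s := by
      change c y ∈ φ.source
      rw [hy]
      exact φ.map_target hwt
    exact ⟨y, hys, by rw [comp_apply, hy, φ.right_inv hwt]⟩
  · -- joined by the chart segment
    set γ : ℝ → M := fun t => φ.symm (φ x₀ + t • (w - φ x₀)) with hγ
    have hseg : ∀ t : unitInterval, φ x₀ + (t : ℝ) • (w - φ x₀) ∈ φ.target := by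
      intro t
      refine hball ?_
      rw [mem_ball, dist_eq_norm, add_sub_cancel_left, norm_smul, Real.norm_eq_abs,
        abs_of_nonneg t.2.1]
      calc (t : ℝ) * ‖w - φ x₀‖ ≤ 1 * ‖w - φ x₀‖ := by gcongr; exact t.2.2
        _ = dist w (φ x₀) := by rw [one_mul, dist_eq_norm]
        _ < r := hwball
    have hγc : Continuous fun t : unitInterval => γ t := by
      refine (continuousOn_extChartAt_symm (I := 𝓡 4) x₀).comp_continuous ?_ hseg
      exact continuous_const.add ((continuous_subtype_val).smul continuous_const)
    refine ⟨⟨⟨fun t => γ t, hγc⟩, ?_, ?_⟩⟩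
    · show γ 0 = x₀
      simp only [hγ, zero_smul, add_zero]
      exact extChartAt_to_inv x₀
    · show γ 1 = φ.symm w
      simp only [hγ, one_smul, add_sub_cancel]

end OffRange

/-! ### Maps from the Riemann sphere to `S⁴` are null-homotopic -/

section NullHomotopy

/-- **Every map `ℂℙ¹ → S⁴` is null-homotopic.** Approximate `f` within `½` by a `C^∞` map
`g : ℂℙ¹ → ℝ⁵` and normalise; `f` and `g/‖g‖` are nowhere antipodal, hence homotopic
(`homotopic_of_forall_add_ne_zero`); the cone over `g(ℂℙ¹)` has Hausdorff dimension `≤ 3 < 5`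
(`dimH_cone_range_le_of_contMDiff`), so some unit vector `y` is not of the form `g(x)/‖g(x)‖`,
and a map into the sphere missing `y` contracts to `-y` (`homotopic_const_of_forall_ne`).
[cite: HirschDT1976, Ch. 3 §1, Prop. 1.2] -/
theorem exists_homotopic_const_of_projectiveLine
    (f : C(ComplexProjectiveSpace 1, sphere (0 : EuclideanSpace ℝ (Fin 5)) 1)) :
    ∃ y : sphere (0 : EuclideanSpace ℝ (Fin 5)) 1, f.Homotopic (ContinuousMap.const _ y) := by
  have hφc : Continuous fun x => (f x : EuclideanSpace ℝ (Fin 5)) :=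
    continuous_subtype_val.comp f.continuous
  have hφ1 : ∀ x, ‖(f x : EuclideanSpace ℝ (Fin 5))‖ = 1 := fun x => norm_eq_of_mem_sphere (f x)
  -- smooth approximation within `1/2`, and its normalisation
  obtain ⟨g, hg, -⟩ := hφc.exists_contMDiff_approx (𝓡 2) (⊤ : ℕ∞) (ε := fun _ => (1 / 2 : ℝ))
    continuous_const (fun _ => one_half_pos)
  have hgφ : ∀ x, ‖g x - (f x : EuclideanSpace ℝ (Fin 5))‖ < 1 / 2 := fun x => by
    rw [← dist_eq_norm]; exact hg x
  have hg0 : ∀ x, g x ≠ 0 := fun x h0 => by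
    have := hgφ x
    rw [h0, zero_sub, norm_neg, hφ1] at this
    norm_num at this
  have hgc : Continuous g := g.contMDiff.continuous
  set fN : ComplexProjectiveSpace 1 → EuclideanSpace ℝ (Fin 5) := fun x => ‖g x‖⁻¹ • g x with hfN
  have hfNc : Continuous fN := (hgc.norm.inv₀ fun x => norm_ne_zero_iff.2 (hg0 x)).smul hgc
  have hfN1 : ∀ x, ‖fN x‖ = 1 := fun x => norm_smul_inv_norm (hg0 x)
  let fN' : C(ComplexProjectiveSpace 1, sphere (0 : EuclideanSpace ℝ (Fin 5)) 1) :=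
    ⟨fun x => ⟨fN x, mem_sphere_zero_iff_norm.2 (hfN1 x)⟩, hfNc.subtype_mk _⟩
  -- `f` and `fN` are nowhere antipodal
  have h1 : f.Homotopic fN' := by
    refine homotopic_of_forall_add_ne_zero f fN' fun x => ?_
    change (f x : EuclideanSpace ℝ (Fin 5)) + fN x ≠ 0
    refine add_ne_zero_of_norm_sub_lt_one (hφ1 x) ?_
    have e1 : ‖g x - fN x‖ = |‖g x‖ - 1| := by
      have : g x - fN x = (‖g x‖ - 1) • fN x := by
        rw [sub_smul, one_smul, hfN]
        simp only
        rw [smul_smul, mul_inv_cancel₀ (norm_ne_zero_iff.2 (hg0 x)), one_smul]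
      rw [this, norm_smul, hfN1, mul_one, Real.norm_eq_abs]
    have e2 : |‖g x‖ - 1| ≤ ‖g x - (f x : EuclideanSpace ℝ (Fin 5))‖ := by
      have h := abs_norm_sub_norm_le (g x) (f x : EuclideanSpace ℝ (Fin 5))
      rwa [hφ1 x] at h
    calc ‖(f x : EuclideanSpace ℝ (Fin 5)) - fN x‖
        ≤ ‖(f x : EuclideanSpace ℝ (Fin 5)) - g x‖ + ‖g x - fN x‖ := norm_sub_le_norm_sub_add_norm_sub _ _ _
      _ < 1 / 2 + 1 / 2 := by
        rw [e1, norm_sub_rev]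
        exact add_lt_add_of_lt_of_le (hgφ x) (e2.trans (hgφ x).le)
      _ = 1 := by norm_num
  -- the cone over `g(ℂℙ¹)` misses a nonzero vector `w`; `fN` misses `w/‖w‖`
  have hcone := dimH_cone_range_le_of_contMDiff (I := 𝓡 2) (g := g)
    (g.contMDiff.of_le (by exact_mod_cast le_top))
  obtain ⟨w, hwC, hw0⟩ := exists_ne_zero_notMem_of_dimH_lt (F := EuclideanSpace ℝ (Fin 5))
    (hcone.trans_lt (by norm_num [finrank_euclideanSpace_fin]))
  set y : sphere (0 : EuclideanSpace ℝ (Fin 5)) 1 :=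
    ⟨‖w‖⁻¹ • w, mem_sphere_zero_iff_norm.2 (norm_smul_inv_norm hw0)⟩ with hy
  have hmiss : ∀ x, fN' x ≠ y := by
    intro x hx
    apply hwC
    have hx' : ‖g x‖⁻¹ • g x = ‖w‖⁻¹ • w := congrArg Subtype.val hx
    refine ⟨(‖w‖ * ‖g x‖⁻¹, x), ?_⟩
    show (‖w‖ * ‖g x‖⁻¹) • g x = w
    rw [mul_smul, hx', smul_smul, mul_inv_cancel₀ (norm_ne_zero_iff.2 hw0), one_smul]
  exact ⟨-y, h1.trans (homotopic_const_of_forall_ne fN' y hmiss)⟩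

variable {M : Type*} [TopologicalSpace M]

/-- Constant maps at points joined by a path are homotopic. [folklore] -/
theorem homotopic_const_of_joined {X : Type*} [TopologicalSpace X] {a a' : M} (h : Joined a a') :
    (ContinuousMap.const X a).Homotopic (ContinuousMap.const X a') := by
  obtain ⟨p⟩ := h
  exact ⟨{ toFun := fun q => p q.1,
           continuous_toFun := p.continuous.comp continuous_fst,
           map_zero_left := fun x => p.source,
           map_one_left := fun x => p.target }⟩

/-- **A map of the Riemann sphere into a space homotopy equivalent to `S⁴` is null-homotopic**
(`π₂(S⁴) = 0`): `c ≃ g ∘ h ∘ c` for the equivalence `h : M → S⁴`, `g : S⁴ → M`, and `h ∘ c` is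
null-homotopic. [folklore] -/
theorem exists_homotopic_const_of_homotopyEquiv_sphere_four
    (e : M ≃ₕ sphere (0 : EuclideanSpace ℝ (Fin 5)) 1) (c : C(ComplexProjectiveSpace 1, M)) :
    ∃ a' : M, (ContinuousMap.const _ a').Homotopic c := by
  obtain ⟨y, hy⟩ := exists_homotopic_const_of_projectiveLine (e.toFun.comp c)
  have h1 : c.Homotopic ((e.invFun.comp e.toFun).comp c) := by
    have := e.left_inv.comp (Homotopic.refl c)
    rw [ContinuousMap.id_comp] at this
    exact this.symm
  have h2 : ((e.invFun.comp e.toFun).comp c).Homotopic (e.invFun.comp (ContinuousMap.const _ y)) := by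
    rw [ContinuousMap.comp_assoc]
    exact (Homotopic.refl e.invFun).comp hy
  refine ⟨e.invFun y, ?_⟩
  have h3 : e.invFun.comp (ContinuousMap.const (ComplexProjectiveSpace 1) y) =
      ContinuousMap.const _ (e.invFun y) := by
    ext x; rfl
  rw [← h3]
  exact (h1.trans h2).symm

end NullHomotopy

/-! ### The framed tube -/

section Main

variable {M : Type} [TopologicalSpace M] [T2Space M] [CompactSpace M]
  [ChartedSpace (EuclideanSpace ℝ (Fin 4)) M] [IsManifold (𝓡 4) ∞ M]

omit [T2Space M] [CompactSpace M] in
/-- **A null-homotopy of the sphere from a point off its image.** For `M ≃ₕ S⁴` and a `C¹` map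
`c : ℂℙ¹ → M` there are `a ∉ c(ℂℙ¹)` and a homotopy `H` from the constant map `a` to `c`.
[folklore] -/
theorem exists_nullhomotopy_offRange (e : M ≃ₕ sphere (0 : EuclideanSpace ℝ (Fin 5)) 1)
    (c : ComplexProjectiveSpace 1 → M) (hc : ContMDiff (𝓡 2) (𝓡 4) 1 c) :
    ∃ a : M, a ∉ range c ∧ ∃ H : ComplexProjectiveSpace 1 × unitInterval → M, Continuous H ∧
      (∀ y, H (y, 0) = a) ∧ ∀ y, H (y, 1) = c y := by
  let cC : C(ComplexProjectiveSpace 1, M) := ⟨c, hc.continuous⟩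
  obtain ⟨a', ha'⟩ := exists_homotopic_const_of_homotopyEquiv_sphere_four e cC
  obtain ⟨y₀⟩ := (inferInstance : Nonempty (ComplexProjectiveSpace 1))
  obtain ⟨a, ha, hjoin⟩ := exists_notMem_range_joined c hc y₀
  -- `a` is joined to `a'`: `a ~ c y₀ ~ a'`
  have hj : Joined a a' := by
    have h1 : Joined a' (c y₀) := ⟨ha'.some.evalAt y₀⟩
    exact (h1.trans hjoin).symm
  obtain ⟨G⟩ := (homotopic_const_of_joined (X := ComplexProjectiveSpace 1) hj).trans ha'
  refine ⟨a, ha, fun q => G (q.2, q.1), G.continuous.comp (continuous_snd.prodMk continuous_fst),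
    fun y => ?_, fun y => ?_⟩
  · exact G.apply_zero y
  · exact G.apply_one y

/-- **An embedded Riemann sphere in a compact homotopy `4`-sphere has a framed tubular
neighbourhood** (Kirby's Theorem VIII.2 — trivial normal bundle of an oriented null-homologous
codimension-two submanifold — for `2`-spheres in homotopy `4`-spheres, where `[c] = 0` and the
orientability of the normal bundle are automatic): for a `C^∞` injective immersion
`c : ℂℙ¹ → M` there is a `C^∞` embedding `ν : ℂℙ¹ × ℝ² → M` with open range and `ν (y, 0) = c y`.
[cite: Kirby1989, Ch. VIII, Thm. 2, pp. 44–45] -/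
theorem exists_framedTube_of_homotopyEquiv_sphere_four
    (hM : Nonempty (M ≃ₕ sphere (0 : EuclideanSpace ℝ (Fin 5)) 1))
    (c : ComplexProjectiveSpace 1 → M) (hc : ContMDiff (𝓡 2) (𝓡 4) ∞ c) (hci : Injective c)
    (hdc : ∀ y, Injective (mfderiv (𝓡 2) (𝓡 4) c y)) :
    ∃ ν : ComplexProjectiveSpace 1 × EuclideanSpace ℝ (Fin 2) → M,
      Manifold.IsSmoothEmbedding ((𝓡 2).prod 𝓘(ℝ, EuclideanSpace ℝ (Fin 2))) (𝓡 4) ∞ ν ∧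
        IsOpen (range ν) ∧ ∀ y, ν (y, 0) = c y := by
  obtain ⟨e⟩ := hM
  -- Whitney embedding and the codimension-two data (at the model `Fin (2 + 2)`)
  obtain ⟨n, w, hw, hwemb, hdw⟩ := exists_embedding_euclidean_of_compact (I := 𝓡 4) (M := M)
  letI i1 : ChartedSpace (EuclideanSpace ℝ (Fin (2 + 2))) M :=
    inferInstanceAs (ChartedSpace (EuclideanSpace ℝ (Fin 4)) M)
  haveI i2 : IsManifold (𝓡 (2 + 2)) ∞ M := inferInstanceAs (IsManifold (𝓡 4) ∞ M)
  let D : CodimTwoData 2 M (ComplexProjectiveSpace 1) (EuclideanSpace ℝ (Fin n)) :=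
    ⟨w, c, hw, hwemb.injective, hdw, hc, hci, hdc⟩
  -- the rotation field and the null-homotopy off the image
  obtain ⟨J, hJ⟩ := D.exists_isRotationField_projectiveLine
  obtain ⟨a, ha, H, hH, hH0, hH1⟩ := exists_nullhomotopy_offRange e c
    (hc.of_le (by exact_mod_cast le_top))
  obtain ⟨ν, h1, h2, h3⟩ := D.exists_framedTube_of_nullhomotopic hJ ha hH hH0 hH1
  exact ⟨ν, h1, h2, h3⟩

end Main

end Literature.Topology.FourManifolds
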